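import Literature.Barriers.CriticalPhenomena.GridSAWSquaresShift
import Literature.Barriers.CriticalPhenomena.GridSAWTowersEnumeration
import HarnessLib

/-!
# Squares step of Theorem 7 (4) (Liśkiewicz–Ogihara–Toda 2003), machine part: the edge list of
# the instance `E₃ - σ` as a FLAT indexed enumeration of unit edges

Sibling of `GridSAWSquaresShift.lean` (the instance `squaresInstance P D s t = (E₃ - σ, τ - σ)`
with `E₃ = withSquares (scaleDrawing k D) (sqSites k β D)`, `k = squaresK N`,
`β = squaresBeta N`, `σ = k • P[s]`; the string map `squaresReduce` and the named machine fact
`LOT2003_thm7_anyLength_squares_FP : squaresReduce ∈ FP ∧ …`) and of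
`GridSAWTowersEnumeration.lean` (the same service for the towered `E₂` of version (1): framed
codes `framesOf c E`, the `ccat` algebra of indexed pieces, `ccat_radix`, `framesOf_flatMap`,
`pathEdges_scalePath`, `blockEdges`). A polynomial-time GENERATOR of the code of `E₃ - σ` is most
simply an indexed fold (`Brick.foldLoop appF piece p`, `FoldBricks.lean`; the towers generator
`GridSAWTowersPieceFn.genItemsFn` is the model) whose piece function computes the `i`-th unit
edge directly from the input and the index. This file supplies the machine-independent half —
WHAT the `i`-th piece is — for the two families of edges of `E₃`, and proves that the pieces
concatenate to the framed code of the instance: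

* family A, the scaled paths: `scaledPieceAt k D c e q t` (the frame of the `t`-th unit edge
  `(runPt k a u t, runPt k a u (t+1))` of the `q`-th scaled unit step `a → a + u` of `D[e]`,
  empty out of range), its flat form `scaledPieceFlat` (mixed radix `(e, q, t)`, `q < Λ =
  maxEdges D`, `t < k`), `framesOf_pathEdges_scalePath` and
  **`framesOf_drawnEdges_scaleDrawing`**;
* family B, the squares: `squarePieceAt k D c e j m` (the frame of the `m`-th of the three new
  edges of the `j`-th square `sqSite k D[e] j`), `squarePieceFlat` (mixed radix `(e, j, m)`,
  `j < β`, `m < 3`), `squareEdges_sqSites` and **`framesOf_squareEdges_sqSites`**;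
* translation commutes with framing (`framesOf_translate`: translate the item coder instead),
  and **`framesOf_squaresInstance`**: the framed code of `(squaresInstance P D s t).1` is the
  family-A concatenation followed by the family-B concatenation, under the translated coder;
  `length_squaresInstance_fst` (the number of edges, for the unary header of the list code:
  `k · Σ_e (|π_e| - 1) + 3 β |D|`).

So the piece of position `(e, q, t)` of family A is decided by `q + 1 < |π_e|` and two
evaluations of `runPt k a u c = k a + c u` at `a = π_e[q]`, `u = π_e[q+1] - π_e[q]`; that of
position `(e, j, m)` of family B by `|π_e| ≥ 2` (always, for a valid drawing) and the corners
`cornerOf k p u c = runPt k p u c + sideVec u` of `GridSAWSquaresPlacement` at `c = 2j+2, 2j+3`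
— integer arithmetic available in `ZIntBricks.lean` and already assembled for `runPt`/`towerPt`
in `GridSAWTowersPieceFn.lean` (Stage D). The brick assembly is the sequel.

## References

* M. Liśkiewicz, M. Ogihara, S. Toda, *The complexity of counting self-avoiding walks in
  subgraphs of two-dimensional grids and hypercubes*, TCS 304 (2003) 129–156, §4, proof of
  Theorem 7 (`E₃`; `R₁` polynomial-time).
* S. Arora, B. Barak, *Computational Complexity: A Modern Approach*, CUP 2009, §0.1 (codes of
  lists), §1.3 (polynomial time: composition and bounded loops).
-/

noncomputable section

namespace Literature.Barriers.CriticalPhenomena.GridSAW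

open Literature.Computability.Complexity Literature.Computability.Complexity.Com

/-! ### Family A: the unit edges of the scaled paths -/

/-- The realised subgraph of the scaled drawing, drawn edge by drawn edge. [folklore] -/
theorem drawnEdges_scaleDrawing (k : ℕ) (D : List DrawnEdge) :
    drawnEdges (scaleDrawing k D) = D.flatMap fun d => pathEdges (scalePath k d.2.2) := by
  simp [drawnEdges, scaleDrawing, List.flatMap_map]

/-- The `t`-th unit edge of the `q`-th scaled unit step of the path `π`: from the run point `t`
to the run point `t + 1` of the run of `(π[q], π[q+1])` scaled by `k` (junk past the end of
`π`, never used). [cite: LiskiewiczOgiharaToda2003, §4 (proof of Theorem 7: "transforming each edge … to the straight line of length λ")] -/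
def scaledEdge (k : ℕ) (π : List GridPoint) (q t : ℕ) : GridPoint × GridPoint :=
  (runPt k (π.getD q 0) (π.getD (q + 1) 0 - π.getD q 0) t,
    runPt k (π.getD q 0) (π.getD (q + 1) 0 - π.getD q 0) (t + 1))

/-- **The piece at position `(e, q, t)` of family A**: the frame, under the item coder `c`, of
the `t`-th unit edge of the `q`-th scaled unit step of the drawn edge `D[e]`; empty when `e` or
`q` is out of range. [cite: LiskiewiczOgiharaToda2003, §4 (proof of Theorem 7, E₃)] -/
def scaledPieceAt (k : ℕ) (D : List DrawnEdge) (c : GridPoint × GridPoint → List Bool)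
    (e q t : ℕ) : List Bool :=
  match D[e]? with
  | none => []
  | some d => if q + 1 < d.2.2.length then repBits 2 (c (scaledEdge k d.2.2 q t)) ++ [false, true]
    else []

/-- **The flat piece function of family A**: position `i < |D| · Λ · k` read in mixed radix
`(e, q, t)`. [cite: LiskiewiczOgiharaToda2003, §4 (proof of Theorem 7, E₃)] -/
def scaledPieceFlat (k Λ : ℕ) (D : List DrawnEdge) (c : GridPoint × GridPoint → List Bool) (i : ℕ) :
    List Bool :=
  scaledPieceAt k D c (i / (Λ * k)) (i % (Λ * k) / k) (i % (Λ * k) % k)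

/-- The number of positions of family A. [folklore] -/
def scaledTotal (k Λ : ℕ) (D : List DrawnEdge) : ℕ := D.length * (Λ * k)

/-- A block without tower is its single run edge, i.e. `scaledEdge`. [folklore] -/
theorem blockEdges_nil (k : ℕ) (π : List GridPoint) (q t : ℕ) :
    blockEdges k (π.getD q 0) (π.getD (q + 1) 0 - π.getD q 0) [] 1 t = [scaledEdge k π q t] :=
  blockEdges_of_not_mem (List.not_mem_nil)

/-- A concatenation of empty pieces is empty. [folklore] -/
theorem ccat_nil_pieces' : ∀ n : ℕ, ccat (fun _ => ([] : List Bool)) n = []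
  | 0 => rfl
  | n + 1 => by rw [ccat_succ, ccat_nil_pieces' n]; rfl

/-- **The framed code of one scaled path, as the concatenation over `(q, t)`** (`q < Λ`,
`t < k`; the pieces with `q + 1 ≥ |π|` are empty). [folklore] -/
theorem framesOf_pathEdges_scalePath {k : ℕ} (hk : 1 ≤ k) (c : GridPoint × GridPoint → List Bool)
    (d : DrawnEdge) (h2 : 2 ≤ d.2.2.length) {Λ : ℕ} (hle : d.2.2.length - 1 ≤ Λ) :
    framesOf c (pathEdges (scalePath k d.2.2)) =
      ccat (fun q => ccat (fun t =>
        if q + 1 < d.2.2.length then repBits 2 (c (scaledEdge k d.2.2 q t)) ++ [false, true]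
        else []) k) Λ := by
  obtain ⟨p, l, hπ⟩ : ∃ p l, d.2.2 = p :: l := by
    match h : d.2.2, h2 with
    | p :: l, _ => exact ⟨p, l, rfl⟩
  rw [hπ, pathEdges_scalePath hk, framesOf_flatMap_range]
  rw [hπ] at hle
  simp only [List.length_cons, Nat.add_sub_cancel] at hle
  rw [ccat_eq_ccat_of_le (g := fun q => ccat _ k) hle (fun i hi => ?_)]
  · refine ccat_congr fun i hi => ?_
    rw [framesOf_flatMap_range]
    refine ccat_congr fun t _ => ?_
    rw [blockEdges_nil, framesOf_singleton, if_pos (by simp; omega)]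
  · rw [ccat_congr (g' := fun _ => []) (fun t _ => by rw [if_neg (by simp; omega)])]
    exact ccat_nil_pieces' _

/-- **The flat enumeration of the scaled paths.** For drawn edges whose paths have at least two
points each and `k ≥ 1`, the framed code of `drawnEdges (scaleDrawing k D)` is the concatenation
of the family-A pieces over all `|D| · Λ · k` positions (`Λ = maxEdges D`): every unit edge is
produced exactly once, in order, from its position `(e, q, t)`.
[cite: LiskiewiczOgiharaToda2003, §4 (proof of Theorem 7, E₃: the scaled drawing)] -/
theorem framesOf_drawnEdges_scaleDrawing {k : ℕ} (hk : 1 ≤ k) {D : List DrawnEdge}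
    (hD : ∀ d ∈ D, 2 ≤ d.2.2.length) (c : GridPoint × GridPoint → List Bool) :
    framesOf c (drawnEdges (scaleDrawing k D)) =
      ccat (scaledPieceFlat k (maxEdges D) D c) (scaledTotal k (maxEdges D) D) := by
  have hΛ : 1 ≤ maxEdges D := one_le_maxEdges D
  have hK : 0 < maxEdges D * k := Nat.mul_pos (by omega) (by omega)
  rw [drawnEdges_scaleDrawing, framesOf_flatMap, scaledTotal]
  refine Eq.trans ?_ (ccat_radix (K := maxEdges D * k)
    (fun e j => scaledPieceAt k D c e (j / k) (j % k)) hK D.length).symm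
  refine ccat_congr fun e he => ?_
  rw [List.getElem?_eq_getElem he]
  dsimp only
  refine Eq.trans ?_ (ccat_radix (K := k) (fun q t => scaledPieceAt k D c e q t) (by omega)
    (maxEdges D)).symm
  rw [framesOf_pathEdges_scalePath hk c _ (hD _ (List.getElem_mem he))
    (length_sub_one_le_maxEdges (List.getElem_mem he))]
  refine ccat_congr fun q _ => ccat_congr fun t _ => ?_
  simp only [scaledPieceAt, List.getElem?_eq_getElem he]

/-! ### Family B: the new edges of the squares -/

/-- The new edges of the squares, drawn edge by drawn edge and square by square. [folklore] -/
theorem squareEdges_sqSites (k β : ℕ) (D : List DrawnEdge) :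
    squareEdges (sqSites k β D) = D.flatMap fun d => (List.range β).flatMap fun j => (sqSite k d j).edges := by
  simp only [squareEdges, sqSites, List.flatMap_assoc, List.flatMap_map]

/-- **The piece at position `(e, j, m)` of family B**: the frame of the `m`-th of the three new
edges `p p′`, `p′ q′`, `q′ q` of the `j`-th square of the drawn edge `D[e]`; empty when `e` or
`m` is out of range. [cite: LiskiewiczOgiharaToda2003, §4 (proof of Theorem 7, E₃: "attach above the line β unit-size squares")] -/
def squarePieceAt (k : ℕ) (D : List DrawnEdge) (c : GridPoint × GridPoint → List Bool)
    (e j m : ℕ) : List Bool :=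
  match D[e]? with
  | none => []
  | some d =>
    match ((sqSite k d j).edges)[m]? with
    | some XY => repBits 2 (c XY) ++ [false, true]
    | none => []

/-- **The flat piece function of family B**: position `i < |D| · β · 3` read in mixed radix
`(e, j, m)`. [cite: LiskiewiczOgiharaToda2003, §4 (proof of Theorem 7, E₃)] -/
def squarePieceFlat (k β : ℕ) (D : List DrawnEdge) (c : GridPoint × GridPoint → List Bool) (i : ℕ) :
    List Bool :=
  squarePieceAt k D c (i / (β * 3)) (i % (β * 3) / 3) (i % (β * 3) % 3)

/-- The number of positions of family B. [folklore] -/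
def squareTotal (β : ℕ) (D : List DrawnEdge) : ℕ := D.length * (β * 3)

/-- A square has three new edges. [folklore] -/
@[simp] theorem length_edges_sqSite (s : SquareSite) : s.edges.length = 3 := rfl

/-- **The flat enumeration of the squares.** The framed code of `squareEdges (sqSites k β D)` is
the concatenation of the family-B pieces over all `|D| · β · 3` positions.
[cite: LiskiewiczOgiharaToda2003, §4 (proof of Theorem 7, E₃: the β squares of every edge)] -/
theorem framesOf_squareEdges_sqSites (k β : ℕ) (D : List DrawnEdge)
    (c : GridPoint × GridPoint → List Bool) :
    framesOf c (squareEdges (sqSites k β D)) = ccat (squarePieceFlat k β D c) (squareTotal β D) := by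
  rw [squareEdges_sqSites, framesOf_flatMap, squareTotal]
  by_cases hβ : β = 0
  · subst hβ
    simp only [Nat.zero_mul, Nat.mul_zero, List.range_zero, List.flatMap_nil]
    refine (ccat_congr (g' := fun _ => []) fun e _ => ?_).trans ?_
    · cases D[e]? <;> rfl
    · rw [ccat_nil_pieces']; rfl
  have hK : 0 < β * 3 := Nat.mul_pos (Nat.pos_of_ne_zero hβ) (by norm_num)
  refine Eq.trans ?_ (ccat_radix (K := β * 3)
    (fun e j => squarePieceAt k D c e (j / 3) (j % 3)) hK D.length).symm
  refine ccat_congr fun e he => ?_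
  rw [List.getElem?_eq_getElem he]
  dsimp only
  refine Eq.trans ?_ (ccat_radix (K := 3) (fun j m => squarePieceAt k D c e j m) (by norm_num) β).symm
  rw [framesOf_flatMap_range]
  refine ccat_congr fun j _ => ?_
  rw [← ccat_getElem?_eq_framesOf c _ 3 (by simp)]
  refine ccat_congr fun m _ => ?_
  simp only [squarePieceAt, List.getElem?_eq_getElem he]
  cases ((sqSite k D[e] j).edges)[m]? <;> rfl

/-! ### Translation and the instance -/

/-- **Translation commutes with framing**: the framed code of a translated edge list is the
framed code of the list under the translated item coder. [folklore] -/
theorem framesOf_translate (c : GridPoint × GridPoint → List Bool) (v : GridPoint) (E : EdgeList) :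
    framesOf c (translate v E) = framesOf (fun XY => c (XY.1 + v, XY.2 + v)) E := by
  simp [framesOf, translate, List.map_map, Function.comp_def]

/-- In a valid drawing every drawn path has at least two points. [folklore] -/
theorem two_le_length_of_mem {P : List GridPoint} {D : List DrawnEdge} (hD : IsGridDrawing P D) :
    ∀ d ∈ D, 2 ≤ d.2.2.length :=
  fun d hd => two_le_length_of_isDrawnEdgeOf hD.1 (hD.2.1 d hd)

/-- **The flat enumeration of the instance of the squares step.** For a valid presentation, the
framed code (item coder `c`) of the edge list `E₃ - σ` of `squaresInstance P D s t` is the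
family-A concatenation (the scaled paths) followed by the family-B concatenation (the
squares), both under the coder translated by `-σ`, `σ = k • P[s]` (`k = squaresK N`,
`β = squaresBeta N`, `Λ = maxEdges D`).
[cite: LiskiewiczOgiharaToda2003, §4 (proof of Theorem 7, E₃; R₁ polynomial-time)] -/
theorem framesOf_squaresInstance {P : List GridPoint} {D : List DrawnEdge} (hD : IsGridDrawing P D)
    (s t : ℕ) (c : GridPoint × GridPoint → List Bool) :
    framesOf c (squaresInstance P D s t).1 =
      ccat (scaledPieceFlat (squaresK P.length) (maxEdges D) D
          (fun XY => c (XY.1 + -((squaresK P.length : ℤ) • img P s),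
            XY.2 + -((squaresK P.length : ℤ) • img P s))))
        (scaledTotal (squaresK P.length) (maxEdges D) D) ++
      ccat (squarePieceFlat (squaresK P.length) (squaresBeta P.length) D
          (fun XY => c (XY.1 + -((squaresK P.length : ℤ) • img P s),
            XY.2 + -((squaresK P.length : ℤ) • img P s))))
        (squareTotal (squaresBeta P.length) D) := by
  have hk : 1 ≤ squaresK P.length := by unfold squaresK; omega
  simp only [squaresInstance]
  rw [framesOf_translate, withSquares, framesOf_append,
    framesOf_drawnEdges_scaleDrawing hk (two_le_length_of_mem hD) _, framesOf_squareEdges_sqSites]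

/-- The number of unit edges of a scaled path: `k` per unit step. [folklore] -/
theorem length_pathEdges_scalePath (k : ℕ) (p : GridPoint) (l : List GridPoint) :
    (pathEdges (scalePath k (p :: l))).length = k * l.length := by
  have h : ∀ π : List GridPoint, (pathEdges π).length = π.length - 1 := by
    intro π
    match π with
    | [] => rfl
    | [_] => rfl
    | a :: b :: π =>
      simp only [pathEdges_cons_cons, List.length_cons]
      have ih : (pathEdges (b :: π)).length = (b :: π).length - 1 := by
        induction π generalizing b with
        | nil => rfl
        | cons x π ih' => simp only [pathEdges_cons_cons, List.length_cons, ih' x]; omega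
      rw [ih]; simp
  rw [h, length_scalePath]
  simp

/-- **The number of edges of the instance** (the unary header of its list code):
`k · Σ_e (|π_e| - 1) + 3 β |D|`. [folklore] -/
theorem length_squaresInstance_fst {P : List GridPoint} {D : List DrawnEdge} (hD : IsGridDrawing P D)
    (s t : ℕ) :
    ((squaresInstance P D s t).1).length =
      squaresK P.length * (D.map fun d => d.2.2.length - 1).sum +
        3 * squaresBeta P.length * D.length := by
  simp only [squaresInstance, translate, List.length_map, withSquares, List.length_append]
  congr 1
  · rw [drawnEdges_scaleDrawing, List.length_flatMap]
    have h : ∀ d ∈ D, (pathEdges (scalePath (squaresK P.length) d.2.2)).length =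
        squaresK P.length * (d.2.2.length - 1) := by
      intro d hd
      obtain ⟨p, q, l, hπ⟩ := exists_eq_cons_cons_of_mem hD hd
      rw [hπ, length_pathEdges_scalePath]
      simp
    rw [List.map_congr_left h, List.sum_map_mul_left]
  · rw [squareEdges_sqSites, List.length_flatMap]
    have h : ∀ d ∈ D, ((List.range (squaresBeta P.length)).flatMap fun j =>
        (sqSite (squaresK P.length) d j).edges).length = 3 * squaresBeta P.length := by
      intro d _
      rw [List.length_flatMap]
      simp [List.sum_replicate, Nat.mul_comm]
    rw [List.map_congr_left h, List.map_const', List.sum_replicate, smul_eq_mul]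
    ring

end Literature.Barriers.CriticalPhenomena.GridSAW
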